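import Summits.QuantumFields.BalabanUV.Beta.FP.RemainderSymbolSliceN

/-!
# `BalabanUV.Beta.FP.RemainderSymbolSliceNBound` — road «FP» for binder row D1, leaf H2-P of the horizontal route, sub-row H2-P-CHAIN-N (owner assignment
# 2026-08-20, R-FP-21 (B2)), PART 3b: the LETTERS of the remainder-symbol chain at every order —
# `‖∂_tⁿ B_w(p)‖ = ‖remSlN w s i α β n t‖ ≤ K_n ∕ ‖p‖ⁿ` on the punctured zone (`p = update s i t`), in the displayed shape H2-P-KER-ASM v1 reads
# (`PerfectPropagatorRemainderSymbol.norm_remSl_wInf_le`), for every `n ≤ N`.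

HONEST DEPENDENCY (page 1, mandatory): continuum YM on T⁴ ⇐ BetaPertH ∧ nine spine estimates (0/9 proved); BetaPertH ⇐ (D1) ∧ (D4) ∧ CAP+tail;
G-an2-4 gates asym, D1 and NE2/3/4.  HONEST FRAMING (cell contract, verbatim): «discharging `BetaPertH` makes Bałaban's UV stability UNCONDITIONAL —
a real constructive-QFT result; it is NOT the continuum limit and NOT the Clay problem.»  THIS MODULE DISCHARGES NOTHING of the wall: [folklore] bookkeeping —
it COMPOSES, by name, `FP/RemainderSymbolChainN.norm_bSlN_le` (this lineage), `FP/InverseSymbolDerivN.norm_iteratedDeriv_matrix_inv_entry_le` ∕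
`norm_iteratedDeriv_inv_real_le` ∕ `iteratedDeriv_apply_entry` (gan24-formalise-leaf-01-g47), `GAN24/InverseRate.norm_le_card_mul`,
`FP/DispersionSliceChain.norm_sq_le_fD` ∕ `fD_pos` ∕ `norm_insertNth_pos` ∕ `norm_insertNth_le_pi` (gan24-formalise-leaf-05-g34), `FP/SliceChainN.pow_trunc_le_geometric`.
0 `def … : Prop`; nothing cited; 0 sorry; 0 wall binders; NOT D1, NOT BetaPertH, NOT continuum, NOT Clay.

ABSOLUTE RULE (cell charter, verbatim): «No internally-minted statement may enter as a cited fact. Every hypothesis is either kernel-proved in this package or a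
verbatim quotation of a PUBLISHED theorem with page reference. The manuscript(s) under audit are NOT citable for their own disputed steps — they are the thing
under adjudication; programme-internal (2001/route/tribunal) claims are never citable.»

WHY / HOW.  The three factors of `B_w = −((feynMat)⁻¹ · excess) · (2ε)⁻¹` have geometric letters with a COMMON ratio once the ratio is taken to be
`Kmax ∕ r` (`r = ‖p‖`, `Kmax = max K_F K_Z ≥ 1`): the inverse Feynman members `‖((feynC)⁻¹)^{(j)} γ δ‖ ≤ (c₀∕r²)·(K_F∕r)^j` (g47's letters, from the
op-norm inputs `‖feynC⁻¹‖ ≤ c₀∕r²` and `‖feynC^{(k)}‖ ≤ (d+1)·K_A·r^{(2−k)}`), the excess members `‖excSl j γ β‖ ≤ K_R·r^{(4−j)} ≤ (K_R·r⁴·π^N)·(r⁻¹)^j`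
(`pow_trunc_le_geometric`, `r ≤ π` on the zone), and the reciprocal dispersion `‖(1∕(2ε))^{(j)}‖ ≤ ((π²∕4)∕r²)·(K_Z∕r)^j` (g47's scalar letters on
`(4∕π²)‖p‖² ≤ 2ε(p)` and `‖(2ε)^{(k)}‖ ≤ 2·‖p‖^{(2−k)}`).  `norm_bSlN_le` multiplies amplitudes: `(c₀∕r²)·(K_R r⁴ π^N)·((π²∕4)∕r²)·(Kmax∕r)^n = K_n∕r^n`.
The Feynman ∕ excess data enter as DISPLAYED POINTWISE HYPOTHESES at `t` (`hfeyn`, `hinv`, `hF`, `hE`) — exactly what H2-P-REG-N (`FP/MaxwellSymbolDerivN`,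
`FP/PerfectSymbolDerivN`, gan24-p3-g16) and H2-P-BND supply for `w = Re W_∞`; this module does not depend on the weight bookkeeping.

WHAT.  Constants `KF N c₀ KA d := 1 + 2^N·c₀·((d+1)·KA)·π^N`, `KZ N := 1 + 2^N·(π²∕4)·2·π^N`, **`Krem N n c₀ KA KR d := (d+1)·2ⁿ·2ⁿ·(c₀·(KR·π^N)·(π²∕4))·(max KF KZ)ⁿ`**;
`max_pi_one`; `c0_nonneg_of_inv_le`; **`norm_remSlN_le`**: under `hfeyn` (entries `C^N` at `t`), `hdet`, `t ∈ [−π,π]`, `q ∈ BZ d ∖ {0}`, `hinv`, `hF`, `hE`: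
`∀ n ≤ N, ‖remSlN w s i α β n t‖ ≤ Krem N n c₀ KA KR d ∕ ‖update s i t‖ⁿ`.
PART 3c (`FP/PerfectPropagatorRemainderSymbolN`) instantiates at `w = Re W_∞` once H2-P-REG-N's instance file is in the tree.

Provenance: binder row D1 formalisation swarm, lineage beta-d1-formalise-leaf-01, gen 8 (prover-b2b-balaban-beta-d1-formalise-leaf-01-g8-0), 2026-08-20;
sub-row H2-P-CHAIN-N of road FP (owner b2b-balaban-beta-d1-p3, GO journal l.21478; display shape requested there).
-/

noncomputable section

namespace Summit.QuantumFields.BalabanUV.Beta.FP.RemainderSymbolSliceNBound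

open Complex Finset Set Filter Matrix
open scoped Matrix.Norms.Operator BigOperators ComplexConjugate Topology
open Literature.MathematicalPhysics.QuantumFieldTheory.Balaban1983to89
open B4ContourShift (BZ)
open B5Prop11Fiber (d1Sym)
open Summit.QuantumFields.BalabanUV.Beta.FP.PerfectPropagatorSymbol (curlRow maxwellMat feynMat)
open Summit.QuantumFields.BalabanUV.Beta.FP.SliceChainN (pow_trunc_le_geometric)
open Summit.QuantumFields.BalabanUV.Beta.FP.RemainderSymbolChainN (bSlN norm_bSlN_le)
open Summit.QuantumFields.BalabanUV.Beta.FP.RemainderSymbolSlice (feynSl excSl update_eq_insertNth)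
open Summit.QuantumFields.BalabanUV.Beta.FP.RemainderSymbolSliceN
open Summit.QuantumFields.BalabanUV.Beta.FP.DispersionSliceChain (fD fD_pos norm_sq_le_fD norm_insertNth_pos norm_insertNth_le_pi)
open Summit.QuantumFields.BalabanUV.Beta.FP.InverseSymbolDerivN (norm_iteratedDeriv_matrix_inv_entry_le norm_iteratedDeriv_inv_real_le iteratedDeriv_apply_entry)
open Summit.QuantumFields.BalabanUV.Beta.GAN24.InverseRate (norm_le_card_mul)

variable {d : ℕ}

/-! ## §1 Constants -/

/-- [our object] the ratio constant of the inverse-Feynman letters: `1 + 2^N·c₀·((d+1)·K_A)·π^N`. -/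
def KF (N : ℕ) (c₀ KA : ℝ) (d : ℕ) : ℝ := 1 + 2 ^ N * c₀ * (((d : ℝ) + 1) * KA) * Real.pi ^ N

/-- [our object] the ratio constant of the reciprocal-dispersion letters: `1 + 2^N·(π²∕4)·2·π^N`. -/
def KZ (N : ℕ) : ℝ := 1 + 2 ^ N * (Real.pi ^ 2 / 4) * 2 * Real.pi ^ N

/-- [our object] **THE REMAINDER-SYMBOL LETTER CONSTANT at order `n ≤ N`**: `(d+1)·2ⁿ·2ⁿ·(c₀·(K_R·π^N)·(π²∕4))·(max KF KZ)ⁿ`. -/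
def Krem (N n : ℕ) (c₀ KA KR : ℝ) (d : ℕ) : ℝ :=
  ((d : ℝ) + 1) * 2 ^ n * 2 ^ n * (c₀ * (KR * Real.pi ^ N) * (Real.pi ^ 2 / 4)) * max (KF N c₀ KA d) (KZ N) ^ n

/-- [folklore] `max π 1 = π`. -/
theorem max_pi_one : max Real.pi 1 = Real.pi := max_eq_left (by linarith [Real.pi_gt_three])

/-- [folklore] `1 ≤ KF` when `0 ≤ c₀`, `0 ≤ KA`. -/
theorem one_le_KF (N : ℕ) {c₀ KA : ℝ} (hc : 0 ≤ c₀) (hA : 0 ≤ KA) (d : ℕ) : 1 ≤ KF N c₀ KA d := by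
  unfold KF
  have : 0 ≤ 2 ^ N * c₀ * (((d : ℝ) + 1) * KA) * Real.pi ^ N := by positivity
  linarith

/-- [folklore] `1 ≤ KZ`. -/
theorem one_le_KZ (N : ℕ) : 1 ≤ KZ N := by
  unfold KZ
  have : 0 ≤ 2 ^ N * (Real.pi ^ 2 / 4) * 2 * Real.pi ^ N := by positivity
  linarith

/-- [folklore] a norm bound `‖x‖ ≤ c₀ ∕ r²` with `0 < r` forces `0 ≤ c₀`. -/
theorem c0_nonneg_of_le {E : Type*} [SeminormedAddCommGroup E] {x : E} {c₀ r : ℝ} (hr : 0 < r) (h : ‖x‖ ≤ c₀ / r ^ 2) : 0 ≤ c₀ := by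
  have h0 : 0 ≤ c₀ / r ^ 2 := (norm_nonneg _).trans h
  have hr2 : 0 < r ^ 2 := by positivity
  by_contra hc
  push Not at hc
  have : c₀ / r ^ 2 < 0 := div_neg_of_neg_of_pos hc hr2
  linarith

/-- [folklore] comparison of geometric ratios: `0 ≤ a ≤ b`, `0 < r` ⟹ `(a∕r)^j ≤ (b∕r)^j`. -/
theorem div_pow_le_div_pow {a b r : ℝ} (ha : 0 ≤ a) (hab : a ≤ b) (hr : 0 < r) (j : ℕ) : (a / r) ^ j ≤ (b / r) ^ j :=
  pow_le_pow_left₀ (div_nonneg ha hr.le) (div_le_div_of_nonneg_right hab hr.le) j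

/-! ## §2 The letters -/

section Letters

variable {w : Fin (d + 1) → Fin (d + 1) → (Fin (d + 1) → ℝ) → ℝ} {s : Fin (d + 1) → ℝ} {i : Fin (d + 1)} {t : ℝ} {N : ℕ} {c₀ KA KR : ℝ}
  (hfeyn : ∀ γ β, ContDiffAt ℝ N (fun u : ℝ => feynMat (fun μ ν => w μ ν (Function.update s i u)) (d1Sym (Function.update s i u)) γ β) t)
  (hdet : IsUnit (feynC w s i t).det)
  (ht : t ∈ Icc (-Real.pi) Real.pi) (hq : i.removeNth s ∈ BZ d) (hq0 : i.removeNth s ≠ 0)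
  (hinv : ‖(feynC w s i t)⁻¹‖ ≤ c₀ / ‖Function.update s i t‖ ^ 2)
  (hKA : 0 ≤ KA)
  (hF : ∀ k, 1 ≤ k → k ≤ N → ∀ γ β, ‖iteratedDeriv k (fun u => feynC w s i u γ β) t‖ ≤ KA * ‖Function.update s i t‖ ^ (2 - k))
  (hE : ∀ k ≤ N, ∀ γ β, ‖excSl w s i k t γ β‖ ≤ KR * ‖Function.update s i t‖ ^ (4 - k))

include hfeyn hKA hF in
/-- [folklore] entry letters ⟹ op-norm letters of the matrix derivatives: `‖feynC^{(k)}(t)‖ ≤ ((d+1)·K_A)·r^{(2−k)}` (`iteratedDeriv_apply_entry` +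
`norm_le_card_mul`). -/
theorem norm_iteratedDeriv_feynC_le :
    ∀ k, 1 ≤ k → k ≤ N → ‖iteratedDeriv k (feynC w s i) t‖ ≤ (((d : ℝ) + 1) * KA) * ‖Function.update s i t‖ ^ (2 - k) := by
  intro k hk1 hk
  have hA := contDiffAt_feynC hfeyn
  have h := norm_le_card_mul (iteratedDeriv k (feynC w s i) t) (c := KA * ‖Function.update s i t‖ ^ (2 - k)) (by positivity)
    (fun γ β => by rw [iteratedDeriv_apply_entry hA hk γ β]; exact hF k hk1 hk γ β)
  rw [Fintype.card_fin] at h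
  push_cast at h
  linarith [h]

include hfeyn hdet ht hq hq0 hinv hKA hF hE in
/-- [our object] **THE LETTERS OF THE REMAINDER-SYMBOL CHAIN AT EVERY ORDER** (displayed shape of H2-P-KER-ASM): for `n ≤ N`,
`‖remSlN w s i α β n t‖ ≤ Krem N n c₀ K_A K_R d ∕ ‖update s i t‖ⁿ`. -/
theorem norm_remSlN_le {n : ℕ} (hn : n ≤ N) (α β : Fin (d + 1)) :
    ‖remSlN w s i α β n t‖ ≤ Krem N n c₀ KA KR d / ‖Function.update s i t‖ ^ n := by
  -- the slice point and its norm
  set p : Fin (d + 1) → ℝ := Function.update s i t with hp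
  have hpins : p = i.insertNth t (i.removeNth s) := by rw [hp, update_eq_insertNth]
  have hr : 0 < ‖p‖ := by rw [hpins]; exact norm_insertNth_pos i t hq0
  have hrπ : ‖p‖ ≤ Real.pi := by rw [hpins]; exact norm_insertNth_le_pi i ht hq
  set r : ℝ := ‖p‖ with hrdef
  have hr0 : r ≠ 0 := hr.ne'
  have hc0 : 0 ≤ c₀ := c0_nonneg_of_le hr hinv
  have hKR : 0 ≤ KR := by
    have h := hE 0 (Nat.zero_le _) α α
    have : 0 ≤ KR * r ^ (4 - 0) := (norm_nonneg _).trans h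
    exact nonneg_of_mul_nonneg_left (by simpa using this) (by positivity)
  -- (P) the inverse-Feynman letters in geometric form
  have hA := contDiffAt_feynC hfeyn
  have hcF := norm_iteratedDeriv_feynC_le hfeyn hKA hF
  set Kf : ℝ := KF N c₀ KA d with hKf
  set Kz : ℝ := KZ N with hKz
  set Km : ℝ := max Kf Kz with hKm
  have hKf1 : 1 ≤ Kf := one_le_KF N hc0 hKA d
  have hKz1 : 1 ≤ Kz := one_le_KZ N
  have hKm1 : 1 ≤ Km := hKf1.trans (le_max_left _ _)
  have hKm0 : 0 ≤ Km := zero_le_one.trans hKm1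
  have hρ : 0 ≤ Km / r := div_nonneg hKm0 hr.le
  have bP : ∀ j ≤ n, ∀ γ δ, ‖invSl w s i j t γ δ‖ ≤ (c₀ / r ^ 2) * (Km / r) ^ j := by
    intro j hj γ δ
    have h := norm_iteratedDeriv_matrix_inv_entry_le hA hdet hr hrπ hinv hcF (hj.trans hn) γ δ
    rw [max_pi_one] at h
    have e : c₀ * (1 + 2 ^ N * c₀ * (((d : ℝ) + 1) * KA) * Real.pi ^ N) ^ j / r ^ (j + 2) = (c₀ / r ^ 2) * (Kf / r) ^ j := by
      rw [hKf, KF, div_pow, pow_add]; field_simp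
    unfold invSl
    refine (h.trans_eq e).trans (mul_le_mul_of_nonneg_left (div_pow_le_div_pow (zero_le_one.trans hKf1) (le_max_left _ _) hr j) ?_)
    positivity
  -- (M) the excess letters in geometric form
  have bM : ∀ j ≤ n, ∀ γ δ, ‖excSl w s i j t γ δ‖ ≤ (KR * r ^ 4 * Real.pi ^ N) * (Km / r) ^ j := by
    intro j hj γ δ
    have h := hE j (hj.trans hn) γ δ
    have hg := pow_trunc_le_geometric (m := 4) hr hrπ (hj.trans hn)
    rw [max_pi_one] at hg
    have h1 : r⁻¹ ^ j ≤ (Km / r) ^ j := by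
      have : r⁻¹ = 1 / r := (one_div r).symm
      rw [this]; exact div_pow_le_div_pow zero_le_one hKm1 hr j
    calc ‖excSl w s i j t γ δ‖ ≤ KR * r ^ (4 - j) := h
      _ ≤ KR * (r ^ 4 * Real.pi ^ N * r⁻¹ ^ j) := mul_le_mul_of_nonneg_left hg hKR
      _ = (KR * r ^ 4 * Real.pi ^ N) * r⁻¹ ^ j := by ring
      _ ≤ (KR * r ^ 4 * Real.pi ^ N) * (Km / r) ^ j := mul_le_mul_of_nonneg_left h1 (by positivity)
  -- (Z) the reciprocal-dispersion letters in geometric form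
  have hfz : ContDiffAt ℝ N (fD (i.removeNth s) i) t := (contDiff_fD (i.removeNth s) i).contDiffAt
  have hft : fD (i.removeNth s) i t ≠ 0 := (fD_pos hq hq0 i t).ne'
  have hpz : ‖(fD (i.removeNth s) i t)⁻¹‖ ≤ (Real.pi ^ 2 / 4) / r ^ 2 := by
    have hlow := norm_sq_le_fD i ht hq
    rw [← hpins] at hlow
    have hpos : 0 < 4 / Real.pi ^ 2 * r ^ 2 := by positivity
    rw [Real.norm_eq_abs, abs_of_pos (inv_pos.mpr (fD_pos hq hq0 i t))]
    calc (fD (i.removeNth s) i t)⁻¹ ≤ (4 / Real.pi ^ 2 * r ^ 2)⁻¹ := inv_anti₀ hpos hlow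
      _ = (Real.pi ^ 2 / 4) / r ^ 2 := by field_simp
  have hcz : ∀ k, 1 ≤ k → k ≤ N → ‖iteratedDeriv k (fD (i.removeNth s) i) t‖ ≤ 2 * r ^ (2 - k) := by
    intro k hk1 _
    have h := norm_iteratedDeriv_fD_le (i.removeNth s) i t k hk1
    rwa [← hpins] at h
  have bZ : ∀ j ≤ n, ‖zSlN s i j t‖ ≤ ((Real.pi ^ 2 / 4) / r ^ 2) * (Km / r) ^ j := by
    intro j hj
    have h := norm_iteratedDeriv_inv_real_le hfz hft hr hrπ hpz hcz j (hj.trans hn)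
    rw [max_pi_one] at h
    have e : Real.pi ^ 2 / 4 * (1 + 2 ^ N * (Real.pi ^ 2 / 4) * 2 * Real.pi ^ N) ^ j / r ^ (j + 2) = ((Real.pi ^ 2 / 4) / r ^ 2) * (Kz / r) ^ j := by
      rw [hKz, KZ, div_pow, pow_add]; field_simp
    unfold zSlN
    rw [Complex.norm_real]
    refine (h.trans_eq e).trans (mul_le_mul_of_nonneg_left (div_pow_le_div_pow (zero_le_one.trans hKz1) (le_max_right _ _) hr j) ?_)
    positivity
  -- compose
  have h := norm_bSlN_le hρ bP bM bZ α β
  unfold remSlN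
  refine h.trans (le_of_eq ?_)
  rw [Krem, ← hKf, ← hKz, ← hKm, Fintype.card_fin, div_pow]
  push_cast
  field_simp

end Letters

end Summit.QuantumFields.BalabanUV.Beta.FP.RemainderSymbolSliceNBound

end
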